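import Literature.Topology.FourManifolds.BoundaryConnectedSum
import HarnessLib

/-!
# Oriented boundary connected sums (relational form)

`Literature/Topology/FourManifolds/BoundaryConnectedSum.lean` defines the boundary connected sum
`X ♮ Y` of manifolds with boundary in relational form (`IsBoundaryConnectedSum`: an open gluing
of the punctured pieces `X ∖ {h₁ 0}`, `Y ∖ {h₂ 0}` along Juhász's relation
`h₁ (t • v) ∼ h₂ ((1 - t) • v)`) and records *no orientation data*, so that `X ♮ Y` and `X ♮ Ȳ`
are not distinguished.  Statements in which chirality matters — e.g. "the boundary connected sum
of PC (Stein) manifolds is PC" (Akbulut–Matveyev 1998, §§3, 5; used there as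
`Ñ = N'' ♮ (-A''₁)`), false for the sum taken against the complex orientations — need the
**oriented boundary connected sum**, defined here exactly as the tree's oriented connected sum
`IsOrientedConnectedSum` (`ConnectedSum.lean`): the gluing embeddings `jA : X ∖ {h₁ 0} → P`,
`jB : Y ∖ {h₂ 0} → P` are required to be orientation preserving for the restricted orientations
of `X`, `Y` (`SmoothOrientation.restrict`) and the given orientation of `P`
(`IsOrientationPreserving`), so that `oP` restricts to `oX` and `oY` on the two pieces
(Gompf–Stipsicz (1999), §1.1: "`X ♮ Y` … is canonically oriented by the orientations of `X` and
`Y`"; Juhász (2023), Def. 1.47).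

* `IsOrientedBoundaryConnectedSum n oX oY oP` (definition) and the proved API
  `.isBoundaryConnectedSum` (forget the orientations), `.neg` (reverse all three),
  `.of_isOpenGluingWith` (constructor).

Design notes.  Unlike `IsOrientedConnectedSum`, no condition "`h₁` preserves / `h₂` reverses a
constant orientation of the model" is recorded: the half-discs are maps of the half space
`EuclideanHalfSpace n`, for which the tree has no model orientation, and the compatibility of
the sum is already carried by `jA`, `jB` (on the overlap `jB⁻¹ ∘ jA = h₂ ∘ (t•v ↦ (1-t)•v) ∘ h₁⁻¹`
is then orientation preserving).  All three manifolds are modelled on the same vector space `E`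
(typically `𝓡∂ n` throughout), as `IsOrientationPreserving` requires.

## References

* A. Juhász, *Differential and Low-Dimensional Topology*, LMS Student Texts 104 (2023),
  Def. 1.47. [Juhasz2023]
* R. E. Gompf, A. I. Stipsicz, *4-Manifolds and Kirby Calculus*, GSM 20 (1999), §1.1
  (boundary sum, orientations). [GompfStipsicz1999]
* S. Akbulut, R. Matveyev, IMRN 1998, §3 and §5. [AkbulutMatveyev1998]
-/

open scoped Manifold ContDiff Topology
open Set Function Module

noncomputable section

namespace Literature.Topology.FourManifolds

section Oriented

variable {E HX HY HP : Type*} [NormedAddCommGroup E] [NormedSpace ℝ E]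
  [TopologicalSpace HX] {IX : ModelWithCorners ℝ E HX}
  [TopologicalSpace HY] {IY : ModelWithCorners ℝ E HY}
  [TopologicalSpace HP] {IP : ModelWithCorners ℝ E HP}
  {X Y P : Type*} [TopologicalSpace X] [T2Space X] [ChartedSpace HX X] [IsManifold IX 1 X]
  [TopologicalSpace Y] [T2Space Y] [ChartedSpace HY Y] [IsManifold IY 1 Y]
  [TopologicalSpace P] [ChartedSpace HP P] [IsManifold IP 1 P]

/-- **Oriented boundary connected sum** (relational form; all three manifolds modelled on the
same vector space `E`).  `IsOrientedBoundaryConnectedSum n oX oY oP` says that the oriented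
manifold `(P, oP)` is the oriented boundary connected sum `(X, oX) ♮ (Y, oY)`: there are smooth
half-disc embeddings `h₁ : EuclideanHalfSpace n → X`, `h₂ : EuclideanHalfSpace n → Y` with open
ranges (half-discs `(H, D) ↪ (X, ∂X)`, `(Y, ∂Y)`, as in `IsBoundaryConnectedSum`) and
*orientation-preserving* open smooth embeddings `jA : X ∖ {h₁ 0} → P`, `jB : Y ∖ {h₂ 0} → P`
(for the restricted orientations `oX.restrict`, `oY.restrict` and `oP`) exhibiting `P` as the
open gluing of the punctured pieces along Juhász's relation `h₁ (t • v) ∼ h₂ ((1 - t) • v)`,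
`‖v‖ = 1`, `0 < t < 1` (`boundaryConnectedSumRel`).  Thus `oP` restricts to `oX` and `oY` on the
two pieces: "`X ♮ Y` is canonically oriented by the orientations of `X` and `Y`".
[cite: Juhasz2023, Def. 1.47] -/
def IsOrientedBoundaryConnectedSum (n : ℕ) [NeZero n] (oX : SmoothOrientation IX X)
    (oY : SmoothOrientation IY Y) (oP : SmoothOrientation IP P) : Prop :=
  ∃ (h₁ : EuclideanHalfSpace n → X) (h₂ : EuclideanHalfSpace n → Y)
    (jA : puncture h₁ → P) (jB : puncture h₂ → P),
    Manifold.IsSmoothEmbedding (𝓡∂ n) IX ∞ h₁ ∧ IsOpen (range h₁) ∧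
    Manifold.IsSmoothEmbedding (𝓡∂ n) IY ∞ h₂ ∧ IsOpen (range h₂) ∧
    (Manifold.IsSmoothEmbedding IX IP ∞ jA ∧ IsOpen (range jA) ∧
      Manifold.IsSmoothEmbedding IY IP ∞ jB ∧ IsOpen (range jB) ∧
      range jA ∪ range jB = univ ∧ ∀ a b, jA a = jB b ↔ boundaryConnectedSumRel h₁ h₂ a b) ∧
    IsOrientationPreserving (oX.restrict (puncture h₁)) oP jA ∧
    IsOrientationPreserving (oY.restrict (puncture h₂)) oP jB

variable {n : ℕ} [NeZero n]

/-- An oriented boundary connected sum is in particular a boundary connected sum (forget the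
orientation data). [cite: Juhasz2023, Def. 1.47] -/
theorem IsOrientedBoundaryConnectedSum.isBoundaryConnectedSum {oX : SmoothOrientation IX X}
    {oY : SmoothOrientation IY Y} {oP : SmoothOrientation IP P}
    (h : IsOrientedBoundaryConnectedSum n oX oY oP) : IsBoundaryConnectedSum n IP IX IY X Y P := by
  obtain ⟨h₁, h₂, jA, jB, e₁, o₁, e₂, o₂, hG, -, -⟩ := h
  exact ⟨h₁, h₂, e₁, o₁, e₂, o₂, jA, jB, hG⟩

/-- Constructor: an open gluing with explicit orientation-preserving gluing maps along
`boundaryConnectedSumRel h₁ h₂`, for half-discs `h₁`, `h₂` with open ranges, is an oriented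
boundary connected sum. [cite: Juhasz2023, Def. 1.47] -/
theorem IsOrientedBoundaryConnectedSum.of_isOpenGluingWith {oX : SmoothOrientation IX X}
    {oY : SmoothOrientation IY Y} {oP : SmoothOrientation IP P}
    {h₁ : EuclideanHalfSpace n → X} {h₂ : EuclideanHalfSpace n → Y}
    (e₁ : Manifold.IsSmoothEmbedding (𝓡∂ n) IX ∞ h₁) (o₁ : IsOpen (range h₁))
    (e₂ : Manifold.IsSmoothEmbedding (𝓡∂ n) IY ∞ h₂) (o₂ : IsOpen (range h₂))
    {jA : puncture h₁ → P} {jB : puncture h₂ → P}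
    (hG : Manifold.IsSmoothEmbedding IX IP ∞ jA ∧ IsOpen (range jA) ∧
      Manifold.IsSmoothEmbedding IY IP ∞ jB ∧ IsOpen (range jB) ∧
      range jA ∪ range jB = univ ∧ ∀ a b, jA a = jB b ↔ boundaryConnectedSumRel h₁ h₂ a b)
    (hA : IsOrientationPreserving (oX.restrict (puncture h₁)) oP jA)
    (hB : IsOrientationPreserving (oY.restrict (puncture h₂)) oP jB) :
    IsOrientedBoundaryConnectedSum n oX oY oP :=
  ⟨h₁, h₂, jA, jB, e₁, o₁, e₂, o₂, hG, hA, hB⟩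

/-- Reversing all three orientations preserves oriented boundary connected sums:
`(-X) ♮ (-Y) = -(X ♮ Y)`. [cite: Juhasz2023, Def. 1.47] -/
theorem IsOrientedBoundaryConnectedSum.neg {oX : SmoothOrientation IX X}
    {oY : SmoothOrientation IY Y} {oP : SmoothOrientation IP P}
    (h : IsOrientedBoundaryConnectedSum n oX oY oP) :
    IsOrientedBoundaryConnectedSum n (-oX) (-oY) (-oP) := by
  obtain ⟨h₁, h₂, jA, jB, e₁, o₁, e₂, o₂, hG, hA, hB⟩ := h
  refine ⟨h₁, h₂, jA, jB, e₁, o₁, e₂, o₂, hG, ?_, ?_⟩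
  · rwa [SmoothOrientation.restrict_neg, isOrientationPreserving_neg_neg_iff]
  · rwa [SmoothOrientation.restrict_neg, isOrientationPreserving_neg_neg_iff]

/-- The symmetric oriented boundary connected sum: `(X, oX) ♮ (Y, oY) = (Y, oY) ♮ (X, oX)` as
relations on the same `(P, oP)` (swap the half-discs and the gluing maps; `t ↦ 1 - t`,
`boundaryConnectedSumRel_swap`). [cite: Juhasz2023, Def. 1.47] -/
theorem IsOrientedBoundaryConnectedSum.symm {oX : SmoothOrientation IX X}
    {oY : SmoothOrientation IY Y} {oP : SmoothOrientation IP P}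
    (h : IsOrientedBoundaryConnectedSum n oX oY oP) :
    IsOrientedBoundaryConnectedSum n oY oX oP := by
  obtain ⟨h₁, h₂, jA, jB, e₁, o₁, e₂, o₂, ⟨sA, oA, sB, oB, hcov, hrel⟩, hA, hB⟩ := h
  refine ⟨h₂, h₁, jB, jA, e₂, o₂, e₁, o₁, ⟨sB, oB, sA, oA, ?_, fun b a => ?_⟩, hB, hA⟩
  · rw [union_comm]; exact hcov
  · rw [← boundaryConnectedSumRel_swap, Function.swap, eq_comm]
    exact hrel a b

end Oriented

end Literature.Topology.FourManifolds

end
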